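import Summits.QuantumFields.YangMills.Theorems.UnitScaleTiltProp7SolutionHessianSupOfRegPr
import Summits.QuantumFields.YangMills.Theorems.UnitScaleTiltProp7PoissonGradientDecayAllMembers
import HarnessLib

/-!
# Route `UnitScaleTilt`, crux K1 «MinimiserStabilityRegPr» (stmt-QuantumFields-19200), EX row (5) `h3` (STOREY H), H-ROAD brick **H7-R (★★OWNER g36 15:09:35Z PRE-CENSUS NOTE (ii),
# RULING №45): THE SUP→SUP COVARIANT HESSIAN ROW AT EVERY MEMBER** — H7 ✓`Prop7SolutionHessianSupOfRegPr.norm_equiv_DL2_slice_DL2_le_of_letters` ∕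
# ✓`norm_covGradT_DL2_le_of_holderLetters` with its no-wrap antecedent `hroom : 2(12·L^{K−n} + 5) ≤ sitesPerDir 0` DELETED and the SAME constant `2·M₀`, by READING H7 ON THE
# `L³`-FOLD COVER `F.cover 3` (px5 g15's (R1)∕(R3) method ✓`Prop7PoissonGradientDecayAllMembers` ∕ ✓`Prop7MassiveSolutionGradientSupAllMembers`): the cover has the room
# (✓`room_cover_three`), `RegPr` lifts (✓`regPr_cover_iff`), the equation `Δ^η_{U₀}u = ω` lifts (✓`covLapSite_cover`), the three SUP letters lift verbatim, the `μ`-slice commutes with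
# the pullback (`formComp (X ∘ π♭) μ = formComp X μ ∘ π`, `rfl`) so the covariant Hessian entries DESCEND (✓`DL2_cover'` twice), read back at a lift (✓`projBond_surjective`).

Cell `ym3-torus` (HUMAN RULING D-0037; rung R3 = SU(2) YM₃ on T³ — NOT d = 4, NOT infinite volume, NOT a mass gap, NOT Clay).  Width seat `ym3-torus-px13` (gen 16);
`--supports stmt-QuantumFields-19200 --as helper`; count-neutral; THEOREMS ONLY (0 `def`, 0 `sorry`, default heartbeats).

THE ONE HONEST CHANGE OF LETTER.  The covariant ½-Hölder letter `H_ω` of H7 is stated in the LOCAL AXIAL GAUGES of radius `4ℓ+1`; on a member WITHOUT room those balls wrap, and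
the member's axial transporter from `π c̃` to `π ỹ` (short way round) differs from the projection of the cover's (which winds) by a holonomy round the member that is NOT small —
so the member-level axial letter does NOT lift.  H7-R therefore takes the Hölder letter ON THE COVER: for the pulled-back datum `ω ∘ π` in the cover's axial gauges
`axialT (U₀ ∘ π♭) c̃` on the cover's balls (binder `hHωt`).  This is what the H-road supplies anyway: H2's PLAIN-difference modulus in a REGULAR gauge (under S47's `hThm2S`) lifts
verbatim to the cover (`d_member ≤ d_cover`, ✓`tdist_siteEquiv_proj_le`; a regular gauge pulls back to a regular gauge), and the bridge H2b (axial transporter of a regular-gauge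
field is Lipschitz) is generic in the family, hence runs ON the cover.  The three sup letters and the conclusion stay at the member; `hsmall` is family-free.

WHAT IS PROVED (ns `Summit.QuantumFields.YangMills.Theorems.Prop7SolutionHessianSupAllMembers`; member `F`, heights `n K`, weight `c₀ > 0`; `0 < ε₀ ≤ 1`, `RegPr F n K ε₀ U₀`;
NO `hroom`).
* §1 `equiv_DL2_cover_bondEquiv` — the pulled-back gradient reads the member's: `(D_{U₀∘π♭}(l∘π)~)(ẽ b̃) = (D_{U₀} l~)(e(π♭ b̃))` (✓`DL2_cover'` + the carriers' `rfl`s) ·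
  `slice_DL2_cover` — `S_μ(D_{U₀∘π♭}(l∘π)~) = ((formComp (toL2⁻¹(D_{U₀}l~)) μ) ∘ π)~` (the slice commutes with the pullback).
* §2 ★★★ `norm_equiv_DL2_slice_DL2_le_of_letters_allMembers` — for `u ω` with `covLapSite F n K c₀ U₀ u = ω`, member sups `M_u, N_ω, M_w`, the COVER Hölder letter `hHωt`, the margin
  `hsmall`: `‖(D_{U₀}(S_μ(D_{U₀}u)))(e b)‖ ≤ 2·M₀` at EVERY route bond `b` — H7 §3's text with `hroom` deleted (and `hHω ↦ hHωt`), SAME `M₀`.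
* §3 ★★★ `norm_covGradT_DL2_le_of_holderLetters_allMembers` — the same in HESS-T1's `covGradT` currency: `‖covGradT (eta F n K) (bgUnits F K U₀) (toL2⁻¹(D_{U₀}u)) μ ν x‖ ≤ 2·M₀` for
  every `μ ν x` — the letter H8-R consumes (px17 g12's ✓`h3_of_holderLetters` re-run with `hroom` deleted and `hHω ↦ hHωt`).
HYP-SAT (★★OWNER RULING №42).  `RegPr`, `0 < ε₀ ≤ 1`, the equation, three real sup letters, one Hölder letter on the cover (inhabited at fixed data by finite maxima; K-free on the
H-road objects by H1+H3 ✓`Prop7StoreyHValueRows` and H2 ∘ H2b), `hsmall` (the ε₀-threshold class, folded by `min` in the STOREY-H package — 17cz (a)); NO room; conclusions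
non-vacuous; no `Prop` hypothesis restates them.  HONEST SCOPE: a cover reading of landed rows; the analysis is (G1-3a)'s∕H4–H6's, not re-done; nothing of H2, H2b, H8-R, `h3`,
norm_G, the EX display, EX `stub_existenceMinimalOrbit`, 19200 or the rung is proved here; the Yang–Mills mass gap is NOT proved.

References: T. Bałaban, CMP **99** (1985) 389–434 [Balaban1985BackgroundPropagators] (Thm 3.1 (3.42)–(3.44) pp.397–398, p.399 L1–3 «the constants do not depend on {Ω_j}», (3.3)
p.391, (3.23) p.394); CMP **96** (1984) 223–250 [Balaban1984PropagatorsII] ((2.15) p.225 — operators on a covering torus, (1.40) p.230, Lemma 2.1 (2.61)–(2.63) p.234); CMP **102**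
(1985) 277–309 [Balaban1985Variational] ((2), (8) p.278, (19) p.281).
-/

set_option autoImplicit false

noncomputable section

open scoped BigOperators Matrix.Norms.L2Operator InnerProductSpace ComplexConjugate

namespace Summit.QuantumFields.YangMills.Theorems.Prop7SolutionHessianSupAllMembers

open Literature.MathematicalPhysics.QuantumFieldTheory.Balaban1983to89
open Literature.MathematicalPhysics.QuantumFieldTheory.Balaban1983to89.T3ContinuumYM3Torus
open B10Eq27TorusAxialLog (axialT)
open B4Sect5Torus (TSite tdist)
open B9SectCLatticeCarrier (Bond)
open B9Eq311L2Pairing (WL2)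
open B11Eq103H1Complex (SiteL2K BondL2K)
open T3PrintedRegularMinimiser (RegPr)
open T3SectALandauChart (eta formComp covGradT bgUnits)
open Summit.QuantumFields.YangMills.Theorems.Prop7SectET3Transport (periodsT3 siteEquiv bondEquiv)
open Summit.QuantumFields.YangMills.Theorems.Prop7SectET3HilbertLetters (W₂ frobEquiv toL2 toL2S DL2 DstarL2 covLapSite toL2_symm_apply toL2_apply toL2S_apply)
open Summit.QuantumFields.YangMills.Theorems.Prop7RieszTauFrobNorm (norm_frobEquiv_le)
open Summit.QuantumFields.YangMills.Theorems.Prop7CurvedMemberLocalHessian (exists_curved_localHessian)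
open Summit.QuantumFields.YangMills.Theorems.AxialGaugeChartGlue (norm_bgOfCfg_axialT_sub_le)
open Summit.QuantumFields.YangMills.Theorems.Prop7LandauDict (DL2_toL2S_eq_covDerivFwdT)
open Summit.QuantumFields.YangMills.Theorems.Prop7SolutionHessianSupOfRegPr (norm_equiv_DL2_slice_DL2_le_of_letters)
open Summit.QuantumFields.YangMills.Theorems.CoverSites
open Summit.QuantumFields.YangMills.Theorems.Prop7CoverHilbertPullback (covLapSite_cover DL2_cover')
open Summit.QuantumFields.YangMills.Theorems.Prop7PoissonGradientDecayAllMembers (room_cover_three)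
open Summit.QuantumFields.YangMills.Theorems.SmallMembersCoverLift (regPr_cover_iff)

variable (F : T3Family) (n K : ℕ) (c₀ : ℝ) [Fact (0 < c₀)]

/-! ## §1 The pulled-back gradient and its slices read the member's -/

/-- **THE PULLED-BACK GRADIENT READS THE MEMBER's**: `(D_{U₀∘π♭}(l∘π)~)(ẽ b̃) = (D_{U₀} l~)(e (π♭ b̃))` in the fibre `W₂` (✓`DL2_cover'` and the two carriers' `rfl`s).
[cite: Balaban1984PropagatorsII, (2.15) p.225; Balaban1985BackgroundPropagators, (3.3) p.391] -/
theorem equiv_DL2_cover_bondEquiv (U₀ : GaugeField (F.P K) 0 (Matrix.specialUnitaryGroup (Fin 2) ℂ)) (l : Site (F.P K) 0 → Matrix (Fin 2) (Fin 2) ℂ)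
    (bt : PBond ((F.cover 3).P K) 0) :
    WL2.equiv ℂ (fun _ : Bond 3 (periodsT3 (F.cover 3) K) => c₀) W₂
        (DL2 (F.cover 3) n K c₀ (U₀ ∘ projBond (F.P K) 3 0) (toL2S (F.cover 3) K c₀ (l ∘ proj (F.P K) 3 0))) (bondEquiv (F.cover 3) K bt)
      = WL2.equiv ℂ (fun _ : Bond 3 (periodsT3 F K) => c₀) W₂ (DL2 F n K c₀ U₀ (toL2S F K c₀ l)) (bondEquiv F K (projBond (F.P K) 3 0 bt)) := by
  rw [DL2_cover', toL2_apply, Equiv.symm_apply_apply, Function.comp_apply, toL2_symm_apply, LinearEquiv.symm_apply_apply]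

/-- **THE SLICE COMMUTES WITH THE PULLBACK**: `S_μ(D_{U₀∘π♭}(l∘π)~) = ((formComp (toL2⁻¹(D_{U₀} l~)) μ) ∘ π)~` — ✓`DL2_cover'` and `formComp (X ∘ π♭) μ = formComp X μ ∘ π` (`rfl`).
[cite: Balaban1984PropagatorsII, (2.15) p.225; Balaban1985Variational, (19) p.281] -/
theorem slice_DL2_cover (U₀ : GaugeField (F.P K) 0 (Matrix.specialUnitaryGroup (Fin 2) ℂ)) (l : Site (F.P K) 0 → Matrix (Fin 2) (Fin 2) ℂ) (μ : Fin 3) :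
    toL2S (F.cover 3) K c₀ (formComp ((toL2 (F.cover 3) K c₀).symm
        (DL2 (F.cover 3) n K c₀ (U₀ ∘ projBond (F.P K) 3 0) (toL2S (F.cover 3) K c₀ (l ∘ proj (F.P K) 3 0)))) μ)
      = toL2S (F.cover 3) K c₀ ((formComp ((toL2 F K c₀).symm (DL2 F n K c₀ U₀ (toL2S F K c₀ l))) μ) ∘ proj (F.P K) 3 0) := by
  rw [DL2_cover', LinearEquiv.symm_apply_apply]
  rfl

/-! ## §2 ★★★ The sup→sup covariant Hessian row at every member (bond currency) -/

section AllMembers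

variable {ε₀ : ℝ} (hε₀ : 0 < ε₀) (hε1 : ε₀ ≤ 1)
  (U₀ : GaugeField (F.P K) 0 (Matrix.specialUnitaryGroup (Fin 2) ℂ)) (hreg : RegPr F n K ε₀ U₀)

include hε₀ hε1 hreg in
/-- ★★★ **THE SUP→SUP COVARIANT HESSIAN ROW — AT EVERY MEMBER, NO ROOM** ([Balaban1985BackgroundPropagators] Thm 3.1 (3.42)–(3.44), Hessian∕Hölder entry; H7 §3
✓`norm_equiv_DL2_slice_DL2_le_of_letters` with `hroom` deleted, SAME constant).  For `u ω` with `Δ^η_{U₀}u = ω`, the member sups `M_u, N_ω, M_w`, the covariant ½-Hölder letter of the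
PULLED-BACK `ω ∘ π` in the axial gauges of the `L³`-fold cover (`hHωt`), and the margin: `‖(D_{U₀}(S_μ(D_{U₀}u)))(e b)‖ ≤ 2·M₀` at EVERY route bond `b` and component `μ`.
PROOF: H7 §3 on the cover `F.cover 3` (room ✓`room_cover_three`, `RegPr` ✓`regPr_cover_iff`, equation ✓`covLapSite_cover`, sups through §1), read back downstairs through §1 at a
lift of `b` (✓`projBond_surjective`). [cite: Balaban1985BackgroundPropagators, Thm 3.1 (3.42)–(3.44) pp.397–398, p.399 L1–3; Balaban1984PropagatorsII, (2.15) p.225, Lemma 2.1 (2.61)–(2.63) p.234] -/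
theorem norm_equiv_DL2_slice_DL2_le_of_letters_allMembers (u ω : SiteL2K ℂ 3 (periodsT3 F K) c₀ W₂) (hEq : covLapSite F n K c₀ U₀ u = ω)
    {Mu Nω Hω Mw : ℝ} (hMu0 : 0 ≤ Mu) (hNω0 : 0 ≤ Nω) (hHω0 : 0 ≤ Hω) (hMw0 : 0 ≤ Mw)
    (hMu : ∀ y : TSite 3 (periodsT3 F K), ‖WL2.equiv ℂ (fun _ : TSite 3 (periodsT3 F K) => c₀) W₂ u y‖ ≤ Mu)
    (hNω : ∀ y : TSite 3 (periodsT3 F K), ‖WL2.equiv ℂ (fun _ : TSite 3 (periodsT3 F K) => c₀) W₂ ω y‖ ≤ Nω)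
    (hMw : ∀ q : Bond 3 (periodsT3 F K), ‖WL2.equiv ℂ (fun _ : Bond 3 (periodsT3 F K) => c₀) W₂ (DL2 F n K c₀ U₀ u) q‖ ≤ Mw)
    (hHωt : ∀ (ct : Site ((F.cover 3).P K) 0) (yt yt' : TSite 3 (periodsT3 (F.cover 3) K)),
      tdist (periodsT3 (F.cover 3) K) (siteEquiv (F.cover 3) K ct) yt ≤ 4 * (F.L : ℝ) ^ (K - n) + 1 →
      tdist (periodsT3 (F.cover 3) K) (siteEquiv (F.cover 3) K ct) yt' ≤ 4 * (F.L : ℝ) ^ (K - n) + 1 →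
      ‖WL2.equiv ℂ (fun _ : TSite 3 (periodsT3 (F.cover 3) K) => c₀) W₂
            (toL2S (F.cover 3) K c₀ (fun zt => ((axialT (U₀ ∘ projBond (F.P K) 3 0) ct zt : Matrix.specialUnitaryGroup (Fin 2) ℂ) : Matrix (Fin 2) (Fin 2) ℂ)
              * (toL2S F K c₀).symm ω (proj (F.P K) 3 0 zt)
              * star ((axialT (U₀ ∘ projBond (F.P K) 3 0) ct zt : Matrix.specialUnitaryGroup (Fin 2) ℂ) : Matrix (Fin 2) (Fin 2) ℂ))) yt'
          - WL2.equiv ℂ (fun _ : TSite 3 (periodsT3 (F.cover 3) K) => c₀) W₂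
            (toL2S (F.cover 3) K c₀ (fun zt => ((axialT (U₀ ∘ projBond (F.P K) 3 0) ct zt : Matrix.specialUnitaryGroup (Fin 2) ℂ) : Matrix (Fin 2) (Fin 2) ℂ)
              * (toL2S F K c₀).symm ω (proj (F.P K) 3 0 zt)
              * star ((axialT (U₀ ∘ projBond (F.P K) 3 0) ct zt : Matrix.specialUnitaryGroup (Fin 2) ℂ) : Matrix (Fin 2) (Fin 2) ℂ))) yt‖
        ≤ Hω * (tdist (periodsT3 (F.cover 3) K) yt yt' / ((F.L : ℝ) ^ (K - n))) ^ ((1 : ℝ) / 2))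
    (hsmall : exists_curved_localHessian.choose * ((48 * ε₀) * (6 * Real.sqrt 2 * Real.sqrt 10 + 6 * Real.sqrt 2)) ≤ 1 / 2) :
    ∀ (μ : Fin 3) (b : PBond (F.P K) 0),
      ‖WL2.equiv ℂ (fun _ : Bond 3 (periodsT3 F K) => c₀) W₂
          (DL2 F n K c₀ U₀ (toL2S F K c₀ (formComp ((toL2 F K c₀).symm (DL2 F n K c₀ U₀ u)) μ))) (bondEquiv F K b)‖
        ≤ 2 * (exists_curved_localHessian.choose *
            (Mw + ((2 * Real.sqrt 2 * (4 * ε₀ * (3 + 2457 * norm_bgOfCfg_axialT_sub_le.choose)) * Nω + Hω)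
              + 2 * Real.sqrt 2 * ((4 * ε₀ * (3 + 2457 * norm_bgOfCfg_axialT_sub_le.choose)) * Mw + (48 * ε₀) * (3 * Real.sqrt 10 * (2 * Real.sqrt 2 * (48 * ε₀) * Mw))))
            + (6 * Real.sqrt 2 * (48 * ε₀) * (Nω + 2 * Real.sqrt 2 * (48 * ε₀) * Mw + 2 * Real.sqrt 2 * (48 * ε₀) * Mw) + Mw
              + Real.sqrt 2 * ((2 * ε₀ + 24 * ε₀ ^ 2) * Mu + 12 * ε₀ * Mw)))
          + 2 * Real.sqrt 2 * (48 * ε₀) * Mw) := by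
  classical
  intro μ b
  -- THE COVER `F.cover 3`: background, regularity, room
  set Ut : GaugeField ((F.cover 3).P K) 0 (Matrix.specialUnitaryGroup (Fin 2) ℂ) := U₀ ∘ projBond (F.P K) 3 0 with hUt
  have hregt : RegPr (F.cover 3) n K ε₀ Ut := (regPr_cover_iff 3 F ε₀ U₀).mpr hreg
  have hroomt : 2 * (12 * (F.cover 3).L ^ (K - n) + 5) ≤ ((F.cover 3).P K).sitesPerDir 0 := room_cover_three F n K
  -- the lifted fields and the lifted equation
  set l : Site (F.P K) 0 → Matrix (Fin 2) (Fin 2) ℂ := (toL2S F K c₀).symm u with hl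
  set lω : Site (F.P K) 0 → Matrix (Fin 2) (Fin 2) ℂ := (toL2S F K c₀).symm ω with hlω
  have hul : toL2S F K c₀ l = u := (toL2S F K c₀).apply_symm_apply u
  set ut : SiteL2K ℂ 3 (periodsT3 (F.cover 3) K) c₀ W₂ := toL2S (F.cover 3) K c₀ (l ∘ proj (F.P K) 3 0) with hut
  set ωt : SiteL2K ℂ 3 (periodsT3 (F.cover 3) K) c₀ W₂ := toL2S (F.cover 3) K c₀ (lω ∘ proj (F.P K) 3 0) with hωt
  have hteq : covLapSite (F.cover 3) n K c₀ Ut ut = ωt := by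
    have hΔ := covLapSite_cover F 3 n K c₀ U₀ l
    rw [hul, hEq] at hΔ
    rw [hUt, hut, hΔ]
  -- values of the lifts
  have hut_apply : ∀ z : TSite 3 (periodsT3 (F.cover 3) K),
      WL2.equiv ℂ (fun _ : TSite 3 (periodsT3 (F.cover 3) K) => c₀) W₂ ut z
        = WL2.equiv ℂ (fun _ : TSite 3 (periodsT3 F K) => c₀) W₂ u (siteEquiv F K (proj (F.P K) 3 0 ((siteEquiv (F.cover 3) K).symm z))) := by
    intro z
    rw [hut, toL2S_apply, Function.comp_apply, ← hul, toL2S_apply, Equiv.symm_apply_apply]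
  have hωt_apply : ∀ z : TSite 3 (periodsT3 (F.cover 3) K),
      WL2.equiv ℂ (fun _ : TSite 3 (periodsT3 (F.cover 3) K) => c₀) W₂ ωt z
        = WL2.equiv ℂ (fun _ : TSite 3 (periodsT3 F K) => c₀) W₂ ω (siteEquiv F K (proj (F.P K) 3 0 ((siteEquiv (F.cover 3) K).symm z))) := by
    intro z
    have hωl : toL2S F K c₀ lω = ω := (toL2S F K c₀).apply_symm_apply ω
    rw [hωt, toL2S_apply, Function.comp_apply, ← hωl, toL2S_apply, Equiv.symm_apply_apply]
  -- the three sup letters upstairs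
  have hMut : ∀ z, ‖WL2.equiv ℂ (fun _ : TSite 3 (periodsT3 (F.cover 3) K) => c₀) W₂ ut z‖ ≤ Mu := fun z => by rw [hut_apply]; exact hMu _
  have hNωt : ∀ z, ‖WL2.equiv ℂ (fun _ : TSite 3 (periodsT3 (F.cover 3) K) => c₀) W₂ ωt z‖ ≤ Nω := fun z => by rw [hωt_apply]; exact hNω _
  have hMwt : ∀ qt : Bond 3 (periodsT3 (F.cover 3) K), ‖WL2.equiv ℂ (fun _ : Bond 3 (periodsT3 (F.cover 3) K) => c₀) W₂ (DL2 (F.cover 3) n K c₀ Ut ut) qt‖ ≤ Mw := by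
    intro qt
    obtain ⟨bt, rfl⟩ := (bondEquiv (F.cover 3) K).surjective qt
    rw [hUt, hut, equiv_DL2_cover_bondEquiv F n K c₀ U₀ l bt, hul]
    exact hMw _
  -- the cover's Hölder letter is the hypothesis (`toL2S⁻¹ ω̃ = ω♭ ∘ π`)
  have hsymm : (toL2S (F.cover 3) K c₀).symm ωt = lω ∘ proj (F.P K) 3 0 := LinearEquiv.symm_apply_apply _ _
  have hHωt' : ∀ (ct : Site ((F.cover 3).P K) 0) (yt yt' : TSite 3 (periodsT3 (F.cover 3) K)),
      tdist (periodsT3 (F.cover 3) K) (siteEquiv (F.cover 3) K ct) yt ≤ 4 * ((F.cover 3).L : ℝ) ^ (K - n) + 1 →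
      tdist (periodsT3 (F.cover 3) K) (siteEquiv (F.cover 3) K ct) yt' ≤ 4 * ((F.cover 3).L : ℝ) ^ (K - n) + 1 →
      ‖WL2.equiv ℂ (fun _ : TSite 3 (periodsT3 (F.cover 3) K) => c₀) W₂
            (toL2S (F.cover 3) K c₀ (fun zt => ((axialT Ut ct zt : Matrix.specialUnitaryGroup (Fin 2) ℂ) : Matrix (Fin 2) (Fin 2) ℂ)
              * (toL2S (F.cover 3) K c₀).symm ωt zt
              * star ((axialT Ut ct zt : Matrix.specialUnitaryGroup (Fin 2) ℂ) : Matrix (Fin 2) (Fin 2) ℂ))) yt'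
          - WL2.equiv ℂ (fun _ : TSite 3 (periodsT3 (F.cover 3) K) => c₀) W₂
            (toL2S (F.cover 3) K c₀ (fun zt => ((axialT Ut ct zt : Matrix.specialUnitaryGroup (Fin 2) ℂ) : Matrix (Fin 2) (Fin 2) ℂ)
              * (toL2S (F.cover 3) K c₀).symm ωt zt
              * star ((axialT Ut ct zt : Matrix.specialUnitaryGroup (Fin 2) ℂ) : Matrix (Fin 2) (Fin 2) ℂ))) yt‖
        ≤ Hω * (tdist (periodsT3 (F.cover 3) K) yt yt' / (((F.cover 3).L : ℝ) ^ (K - n))) ^ ((1 : ℝ) / 2) := by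
    intro ct yt yt' h1 h2
    rw [hsymm]
    exact hHωt ct yt yt' h1 h2
  -- H7 §3 ON THE COVER
  have hcov := norm_equiv_DL2_slice_DL2_le_of_letters (F.cover 3) n K c₀ hε₀ hε1 Ut hregt ut ωt hteq hMu0 hNω0 hHω0 hMw0 hMut hNωt hMwt hHωt' hroomt hsmall μ
  -- READ BACK DOWNSTAIRS at a lift `b̃` of `b`
  obtain ⟨bt, hbt⟩ := projBond_surjective (F.P K) 3 0 b
  have e : WL2.equiv ℂ (fun _ : Bond 3 (periodsT3 (F.cover 3) K) => c₀) W₂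
        (DL2 (F.cover 3) n K c₀ Ut (toL2S (F.cover 3) K c₀ (formComp ((toL2 (F.cover 3) K c₀).symm (DL2 (F.cover 3) n K c₀ Ut ut)) μ))) (bondEquiv (F.cover 3) K bt)
      = WL2.equiv ℂ (fun _ : Bond 3 (periodsT3 F K) => c₀) W₂
        (DL2 F n K c₀ U₀ (toL2S F K c₀ (formComp ((toL2 F K c₀).symm (DL2 F n K c₀ U₀ u)) μ))) (bondEquiv F K b) := by
    rw [hUt, hut, slice_DL2_cover F n K c₀ U₀ l μ, equiv_DL2_cover_bondEquiv F n K c₀ U₀ _ bt, hul, hbt]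
  rw [← e]
  exact hcov (bondEquiv (F.cover 3) K bt)

/-! ## §3 ★★★ The same row in the route's `covGradT` currency — the letter H8-R consumes -/

include hε₀ hε1 hreg in
/-- ★★★ **H7-R — THE COVARIANT HESSIAN OF A SOLUTION OF `Δ^η_{U₀}u = ω` IN SUP AT EVERY MEMBER, `covGradT` CURRENCY, NO ROOM**: for every `μ ν x`,
`‖covGradT (eta F n K) (bgUnits F K U₀) (toL2⁻¹(D_{U₀}u)) μ ν x‖ ≤ 2·M₀(ε₀; M_u, N_ω, H_ω, M_w)` — §2 through the dictionary ✓`DL2_toL2S_eq_covDerivFwdT` and operator norm ≤ Frobenius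
norm ✓`norm_frobEquiv_le`; H7's ✓`norm_covGradT_DL2_le_of_holderLetters` with `hroom` deleted and the Hölder letter read on the cover.
[cite: Balaban1985BackgroundPropagators, Thm 3.1 (3.42)–(3.44) pp.397–398, p.399 L1–3, (3.3) p.391; Balaban1985Variational, (19) p.281; Balaban1984PropagatorsII, (1.40) p.230, (2.15) p.225] -/
theorem norm_covGradT_DL2_le_of_holderLetters_allMembers (u ω : SiteL2K ℂ 3 (periodsT3 F K) c₀ W₂) (hEq : covLapSite F n K c₀ U₀ u = ω)
    {Mu Nω Hω Mw : ℝ} (hMu0 : 0 ≤ Mu) (hNω0 : 0 ≤ Nω) (hHω0 : 0 ≤ Hω) (hMw0 : 0 ≤ Mw)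
    (hMu : ∀ y : TSite 3 (periodsT3 F K), ‖WL2.equiv ℂ (fun _ : TSite 3 (periodsT3 F K) => c₀) W₂ u y‖ ≤ Mu)
    (hNω : ∀ y : TSite 3 (periodsT3 F K), ‖WL2.equiv ℂ (fun _ : TSite 3 (periodsT3 F K) => c₀) W₂ ω y‖ ≤ Nω)
    (hMw : ∀ q : Bond 3 (periodsT3 F K), ‖WL2.equiv ℂ (fun _ : Bond 3 (periodsT3 F K) => c₀) W₂ (DL2 F n K c₀ U₀ u) q‖ ≤ Mw)
    (hHωt : ∀ (ct : Site ((F.cover 3).P K) 0) (yt yt' : TSite 3 (periodsT3 (F.cover 3) K)),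
      tdist (periodsT3 (F.cover 3) K) (siteEquiv (F.cover 3) K ct) yt ≤ 4 * (F.L : ℝ) ^ (K - n) + 1 →
      tdist (periodsT3 (F.cover 3) K) (siteEquiv (F.cover 3) K ct) yt' ≤ 4 * (F.L : ℝ) ^ (K - n) + 1 →
      ‖WL2.equiv ℂ (fun _ : TSite 3 (periodsT3 (F.cover 3) K) => c₀) W₂
            (toL2S (F.cover 3) K c₀ (fun zt => ((axialT (U₀ ∘ projBond (F.P K) 3 0) ct zt : Matrix.specialUnitaryGroup (Fin 2) ℂ) : Matrix (Fin 2) (Fin 2) ℂ)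
              * (toL2S F K c₀).symm ω (proj (F.P K) 3 0 zt)
              * star ((axialT (U₀ ∘ projBond (F.P K) 3 0) ct zt : Matrix.specialUnitaryGroup (Fin 2) ℂ) : Matrix (Fin 2) (Fin 2) ℂ))) yt'
          - WL2.equiv ℂ (fun _ : TSite 3 (periodsT3 (F.cover 3) K) => c₀) W₂
            (toL2S (F.cover 3) K c₀ (fun zt => ((axialT (U₀ ∘ projBond (F.P K) 3 0) ct zt : Matrix.specialUnitaryGroup (Fin 2) ℂ) : Matrix (Fin 2) (Fin 2) ℂ)
              * (toL2S F K c₀).symm ω (proj (F.P K) 3 0 zt)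
              * star ((axialT (U₀ ∘ projBond (F.P K) 3 0) ct zt : Matrix.specialUnitaryGroup (Fin 2) ℂ) : Matrix (Fin 2) (Fin 2) ℂ))) yt‖
        ≤ Hω * (tdist (periodsT3 (F.cover 3) K) yt yt' / ((F.L : ℝ) ^ (K - n))) ^ ((1 : ℝ) / 2))
    (hsmall : exists_curved_localHessian.choose * ((48 * ε₀) * (6 * Real.sqrt 2 * Real.sqrt 10 + 6 * Real.sqrt 2)) ≤ 1 / 2)
    (μ ν : Fin (F.P K).d) (x : Site (F.P K) 0) :
    ‖covGradT (eta F n K) (bgUnits F K U₀) ((toL2 F K c₀).symm (DL2 F n K c₀ U₀ u)) μ ν x‖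
      ≤ 2 * (exists_curved_localHessian.choose *
            (Mw + ((2 * Real.sqrt 2 * (4 * ε₀ * (3 + 2457 * norm_bgOfCfg_axialT_sub_le.choose)) * Nω + Hω)
              + 2 * Real.sqrt 2 * ((4 * ε₀ * (3 + 2457 * norm_bgOfCfg_axialT_sub_le.choose)) * Mw + (48 * ε₀) * (3 * Real.sqrt 10 * (2 * Real.sqrt 2 * (48 * ε₀) * Mw))))
            + (6 * Real.sqrt 2 * (48 * ε₀) * (Nω + 2 * Real.sqrt 2 * (48 * ε₀) * Mw + 2 * Real.sqrt 2 * (48 * ε₀) * Mw) + Mw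
              + Real.sqrt 2 * ((2 * ε₀ + 24 * ε₀ ^ 2) * Mu + 12 * ε₀ * Mw)))
          + 2 * Real.sqrt 2 * (48 * ε₀) * Mw) := by
  have hdict : covGradT (eta F n K) (bgUnits F K U₀) ((toL2 F K c₀).symm (DL2 F n K c₀ U₀ u)) μ ν x
      = (toL2 F K c₀).symm (DL2 F n K c₀ U₀ (toL2S F K c₀ (formComp ((toL2 F K c₀).symm (DL2 F n K c₀ U₀ u)) ν))) ⟨x, μ⟩ := by
    rw [DL2_toL2S_eq_covDerivFwdT]; rfl
  rw [hdict, toL2_symm_apply]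
  exact (norm_frobEquiv_le _).trans
    (norm_equiv_DL2_slice_DL2_le_of_letters_allMembers F n K c₀ hε₀ hε1 U₀ hreg u ω hEq hMu0 hNω0 hHω0 hMw0 hMu hNω hMw hHωt hsmall ν ⟨x, μ⟩)

end AllMembers

end Summit.QuantumFields.YangMills.Theorems.Prop7SolutionHessianSupAllMembers

end
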